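import Mathlib
import Summits.Ventures.PercRepro2.CoinChainXAClosedGateGenSums

/-!
# The cell facts of an M-supported gate, and the killed-vs-sure-entered two-marker facts
(blind cell PercRepro2, night-2 g31; proofs/NIGHT2-DARC.md §73.6)

Ahlswede–Daykin facts on the sure-entered clusters (`m ∈ W`) between the law `νd` and a gate law `νd'`, in the
WEIGHTED vocabulary of the entry markers `x = 1[j ∈ ·]`, `y = 1[j' ∈ ·]` (the cell weights `(1 − x)(1 − y)`,
`x(1 − y)`, `(1 − x)y`, `xy`): the gate ratio is increasing cell by cell (`mg_fact_ratio0x`: the unmarked gate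
mass against the `x`-only `d`-mass, `mg_fact_ratiox`: the `x`-only gate mass against the top `d`-mass) and the
gate law is log-supermodular across the two one-sided cells (`mg_fact_hyp`: `rₓ·r_y ≤ r₀·ω`).  Also the
killed-vs-sure-entered two-marker fact in weighted form (`mg_fact_IM`: `XJ·(YM − XYM) ≤ (a + δ − XJ)·XYM`, the
`IM_x` fact of §72.11 without the cell predicates).  All by `ad_sets_dec`; the marker arithmetic is a case
split on the memberships of `j`, `j'`.
-/

namespace Summit.Ventures.PercRepro2.Coin

open Classical

section MGateFacts

variable {V : Type*} [DecidableEq V] {R : Type*} [Field R] [LinearOrder R] [IsStrictOrderedRing R]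
variable (U : Finset V) (m j j' : V) (ν d d' : Finset V → R)
variable (hν0 : ∀ W, 0 ≤ ν W) (hν : ∀ s ⊆ U, ∀ t ⊆ U, ν s * ν t ≤ ν (s ∩ t) * ν (s ∪ t))
  (hd0 : ∀ W, 0 ≤ d W) (hd'0 : ∀ W, 0 ≤ d' W)
  (hd'd' : ∀ s t, d' s * d' t ≤ d' (s ∩ t) * d' (s ∪ t))
  (hdd' : ∀ s t, d s * d' t ≤ d (s ∩ t) * d' (s ∪ t))
  (x y : Finset V → R) (hx : ∀ W, x W = if j ∈ W then 1 else 0) (hy : ∀ W, y W = if j' ∈ W then 1 else 0)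

omit [LinearOrder R] [IsStrictOrderedRing R] in
include hx in
/-- A point marker takes the values `0` and `1`. -/
lemma mg_marker_cases (W : Finset V) : x W = 0 ∨ x W = 1 := by
  rw [hx W]; split_ifs <;> simp

include hx in
/-- `0 ≤ x`. -/
lemma mg_x0 (W : Finset V) : 0 ≤ x W := by rw [hx W]; split_ifs <;> norm_num

include hx in
/-- `x ≤ 1`. -/
lemma mg_x1 (W : Finset V) : x W ≤ 1 := by rw [hx W]; split_ifs <;> norm_num

omit [LinearOrder R] [IsStrictOrderedRing R] in
include hx in
/-- The point marker of a meet is the product. -/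
lemma mg_x_inter (s t : Finset V) : x (s ∩ t) = x s * x t := by
  rw [hx, hx, hx]
  by_cases hs : j ∈ s <;> by_cases ht : j ∈ t <;> simp [hs, ht]

omit [LinearOrder R] [IsStrictOrderedRing R] in
include hx in
/-- The point marker of a join: `1` iff one of the two. -/
lemma mg_x_union (s t : Finset V) : x (s ∪ t) = x s + x t - x s * x t := by
  rw [hx, hx, hx]
  by_cases hs : j ∈ s <;> by_cases ht : j ∈ t <;> simp [hs, ht]

include hν0 hν hd0 hd'0 hdd' hx hy in
/-- **The unmarked gate mass against the `x`-only `d`-mass**: `r₀·b₁ ≤ rₓ·b` — the meet is unmarked, the join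
`x`-only (`(G, B) → (B, G)`: the gate ratio is increasing). -/
theorem mg_fact_ratio0x :
    (∑ W ∈ U.powerset.filter (fun W => ∃ r ∈ ({m} : Finset V), r ∈ W), ν W * d' W * ((1 - x W) * (1 - y W)))
      * (∑ W ∈ U.powerset.filter (fun W => ∃ r ∈ ({m} : Finset V), r ∈ W), ν W * d W * (x W * (1 - y W))) ≤
    (∑ W ∈ U.powerset.filter (fun W => ∃ r ∈ ({m} : Finset V), r ∈ W), ν W * d W * ((1 - x W) * (1 - y W)))
      * (∑ W ∈ U.powerset.filter (fun W => ∃ r ∈ ({m} : Finset V), r ∈ W), ν W * d' W * (x W * (1 - y W))) := by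
  have hx0 := mg_x0 j x hx; have hy0 := mg_x0 j' y hy; have hx1 := mg_x1 j x hx; have hy1 := mg_x1 j' y hy
  refine ad_sets_dec U (fun W => ν W * d' W * ((1 - x W) * (1 - y W))) (fun W => ν W * d W * (x W * (1 - y W)))
    (fun W => ν W * d W * ((1 - x W) * (1 - y W))) (fun W => ν W * d' W * (x W * (1 - y W)))
    (fun W => mul_nonneg (mul_nonneg (hν0 W) (hd'0 W)) (mul_nonneg (by linarith [hx1 W]) (by linarith [hy1 W])))
    (fun W => mul_nonneg (mul_nonneg (hν0 W) (hd0 W)) (mul_nonneg (hx0 W) (by linarith [hy1 W])))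
    (fun W => mul_nonneg (mul_nonneg (hν0 W) (hd0 W)) (mul_nonneg (by linarith [hx1 W]) (by linarith [hy1 W])))
    (fun W => mul_nonneg (mul_nonneg (hν0 W) (hd'0 W)) (mul_nonneg (hx0 W) (by linarith [hy1 W])))
    (fun W => ∃ r ∈ ({m} : Finset V), r ∈ W) (fun W => ∃ r ∈ ({m} : Finset V), r ∈ W)
    (fun W => ∃ r ∈ ({m} : Finset V), r ∈ W) (fun W => ∃ r ∈ ({m} : Finset V), r ∈ W) ?_
  intro s hs t ht hA hB
  obtain ⟨r, hr, hrs⟩ := hA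
  obtain ⟨r', hr', hrt⟩ := hB
  have hms : m ∈ s := Finset.mem_singleton.1 hr ▸ hrs
  have hmt : m ∈ t := Finset.mem_singleton.1 hr' ▸ hrt
  refine ⟨⟨m, Finset.mem_singleton_self m, Finset.mem_inter.2 ⟨hms, hmt⟩⟩,
    ⟨m, Finset.mem_singleton_self m, Finset.mem_union.2 (Or.inl hms)⟩, ?_⟩
  have hlaw : ν s * d' s * (ν t * d t) ≤ ν (s ∩ t) * d (s ∩ t) * (ν (s ∪ t) * d' (s ∪ t)) := by
    have h1 := hdd' t s
    rw [Finset.inter_comm, Finset.union_comm] at h1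
    calc ν s * d' s * (ν t * d t) = (ν s * ν t) * (d t * d' s) := by ring
      _ ≤ (ν (s ∩ t) * ν (s ∪ t)) * (d (s ∩ t) * d' (s ∪ t)) :=
          mul_le_mul (hν s hs t ht) h1 (mul_nonneg (hd0 t) (hd'0 s)) (mul_nonneg (hν0 _) (hν0 _))
      _ = ν (s ∩ t) * d (s ∩ t) * (ν (s ∪ t) * d' (s ∪ t)) := by ring
  have hlaw0 : 0 ≤ ν (s ∩ t) * d (s ∩ t) * (ν (s ∪ t) * d' (s ∪ t)) :=
    mul_nonneg (mul_nonneg (hν0 _) (hd0 _)) (mul_nonneg (hν0 _) (hd'0 _))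
  -- the marker arithmetic: the weights are `0/1`
  rw [mg_x_inter j x hx, mg_x_inter j' y hy, mg_x_union j x hx, mg_x_union j' y hy]
  rcases mg_marker_cases j x hx s with hxs | hxs <;> rcases mg_marker_cases j x hx t with hxt | hxt <;>
    rcases mg_marker_cases j' y hy s with hys | hys <;> rcases mg_marker_cases j' y hy t with hyt | hyt <;>
    simp only [hxs, hxt, hys, hyt] <;> ring_nf <;> nlinarith [hlaw, hlaw0]

include hν0 hν hd0 hd'0 hdd' hx hy in
/-- **The `x`-only gate mass against the top `d`-mass**: `rₓ·b₁₂ ≤ ω·b₁` — the meet is `x`-only, the join is the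
top cell (`(G, B) → (B, G)`). -/
theorem mg_fact_ratiox :
    (∑ W ∈ U.powerset.filter (fun W => ∃ r ∈ ({m} : Finset V), r ∈ W), ν W * d' W * (x W * (1 - y W)))
      * (∑ W ∈ U.powerset.filter (fun W => ∃ r ∈ ({m} : Finset V), r ∈ W), ν W * d W * (x W * y W)) ≤
    (∑ W ∈ U.powerset.filter (fun W => ∃ r ∈ ({m} : Finset V), r ∈ W), ν W * d W * (x W * (1 - y W)))
      * (∑ W ∈ U.powerset.filter (fun W => ∃ r ∈ ({m} : Finset V), r ∈ W), ν W * d' W * (x W * y W)) := by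
  have hx0 := mg_x0 j x hx; have hy0 := mg_x0 j' y hy; have hx1 := mg_x1 j x hx; have hy1 := mg_x1 j' y hy
  refine ad_sets_dec U (fun W => ν W * d' W * (x W * (1 - y W))) (fun W => ν W * d W * (x W * y W))
    (fun W => ν W * d W * (x W * (1 - y W))) (fun W => ν W * d' W * (x W * y W))
    (fun W => mul_nonneg (mul_nonneg (hν0 W) (hd'0 W)) (mul_nonneg (hx0 W) (by linarith [hy1 W])))
    (fun W => mul_nonneg (mul_nonneg (hν0 W) (hd0 W)) (mul_nonneg (hx0 W) (hy0 W)))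
    (fun W => mul_nonneg (mul_nonneg (hν0 W) (hd0 W)) (mul_nonneg (hx0 W) (by linarith [hy1 W])))
    (fun W => mul_nonneg (mul_nonneg (hν0 W) (hd'0 W)) (mul_nonneg (hx0 W) (hy0 W)))
    (fun W => ∃ r ∈ ({m} : Finset V), r ∈ W) (fun W => ∃ r ∈ ({m} : Finset V), r ∈ W)
    (fun W => ∃ r ∈ ({m} : Finset V), r ∈ W) (fun W => ∃ r ∈ ({m} : Finset V), r ∈ W) ?_
  intro s hs t ht hA hB
  obtain ⟨r, hr, hrs⟩ := hA
  obtain ⟨r', hr', hrt⟩ := hB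
  have hms : m ∈ s := Finset.mem_singleton.1 hr ▸ hrs
  have hmt : m ∈ t := Finset.mem_singleton.1 hr' ▸ hrt
  refine ⟨⟨m, Finset.mem_singleton_self m, Finset.mem_inter.2 ⟨hms, hmt⟩⟩,
    ⟨m, Finset.mem_singleton_self m, Finset.mem_union.2 (Or.inl hms)⟩, ?_⟩
  have hlaw : ν s * d' s * (ν t * d t) ≤ ν (s ∩ t) * d (s ∩ t) * (ν (s ∪ t) * d' (s ∪ t)) := by
    have h1 := hdd' t s
    rw [Finset.inter_comm, Finset.union_comm] at h1
    calc ν s * d' s * (ν t * d t) = (ν s * ν t) * (d t * d' s) := by ring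
      _ ≤ (ν (s ∩ t) * ν (s ∪ t)) * (d (s ∩ t) * d' (s ∪ t)) :=
          mul_le_mul (hν s hs t ht) h1 (mul_nonneg (hd0 t) (hd'0 s)) (mul_nonneg (hν0 _) (hν0 _))
      _ = ν (s ∩ t) * d (s ∩ t) * (ν (s ∪ t) * d' (s ∪ t)) := by ring
  have hlaw0 : 0 ≤ ν (s ∩ t) * d (s ∩ t) * (ν (s ∪ t) * d' (s ∪ t)) :=
    mul_nonneg (mul_nonneg (hν0 _) (hd0 _)) (mul_nonneg (hν0 _) (hd'0 _))
  rw [mg_x_inter j x hx, mg_x_inter j' y hy, mg_x_union j x hx, mg_x_union j' y hy]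
  rcases mg_marker_cases j x hx s with hxs | hxs <;> rcases mg_marker_cases j x hx t with hxt | hxt <;>
    rcases mg_marker_cases j' y hy s with hys | hys <;> rcases mg_marker_cases j' y hy t with hyt | hyt <;>
    simp only [hxs, hxt, hys, hyt] <;> ring_nf <;> nlinarith [hlaw, hlaw0]

include hν0 hν hd'0 hd'd' hx hy in
/-- **The hyperbola**: `rₓ·r_y ≤ r₀·ω` — the `x`-only and `y`-only gate masses against the unmarked and top ones
(`(G, G) → (G, G)`: the gate law is log-supermodular). -/
theorem mg_fact_hyp :
    (∑ W ∈ U.powerset.filter (fun W => ∃ r ∈ ({m} : Finset V), r ∈ W), ν W * d' W * (x W * (1 - y W)))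
      * (∑ W ∈ U.powerset.filter (fun W => ∃ r ∈ ({m} : Finset V), r ∈ W), ν W * d' W * ((1 - x W) * y W)) ≤
    (∑ W ∈ U.powerset.filter (fun W => ∃ r ∈ ({m} : Finset V), r ∈ W), ν W * d' W * ((1 - x W) * (1 - y W)))
      * (∑ W ∈ U.powerset.filter (fun W => ∃ r ∈ ({m} : Finset V), r ∈ W), ν W * d' W * (x W * y W)) := by
  have hx0 := mg_x0 j x hx; have hy0 := mg_x0 j' y hy; have hx1 := mg_x1 j x hx; have hy1 := mg_x1 j' y hy
  refine ad_sets_dec U (fun W => ν W * d' W * (x W * (1 - y W))) (fun W => ν W * d' W * ((1 - x W) * y W))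
    (fun W => ν W * d' W * ((1 - x W) * (1 - y W))) (fun W => ν W * d' W * (x W * y W))
    (fun W => mul_nonneg (mul_nonneg (hν0 W) (hd'0 W)) (mul_nonneg (hx0 W) (by linarith [hy1 W])))
    (fun W => mul_nonneg (mul_nonneg (hν0 W) (hd'0 W)) (mul_nonneg (by linarith [hx1 W]) (hy0 W)))
    (fun W => mul_nonneg (mul_nonneg (hν0 W) (hd'0 W)) (mul_nonneg (by linarith [hx1 W]) (by linarith [hy1 W])))
    (fun W => mul_nonneg (mul_nonneg (hν0 W) (hd'0 W)) (mul_nonneg (hx0 W) (hy0 W)))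
    (fun W => ∃ r ∈ ({m} : Finset V), r ∈ W) (fun W => ∃ r ∈ ({m} : Finset V), r ∈ W)
    (fun W => ∃ r ∈ ({m} : Finset V), r ∈ W) (fun W => ∃ r ∈ ({m} : Finset V), r ∈ W) ?_
  intro s hs t ht hA hB
  obtain ⟨r, hr, hrs⟩ := hA
  obtain ⟨r', hr', hrt⟩ := hB
  have hms : m ∈ s := Finset.mem_singleton.1 hr ▸ hrs
  have hmt : m ∈ t := Finset.mem_singleton.1 hr' ▸ hrt
  refine ⟨⟨m, Finset.mem_singleton_self m, Finset.mem_inter.2 ⟨hms, hmt⟩⟩,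
    ⟨m, Finset.mem_singleton_self m, Finset.mem_union.2 (Or.inl hms)⟩, ?_⟩
  have hlaw : ν s * d' s * (ν t * d' t) ≤ ν (s ∩ t) * d' (s ∩ t) * (ν (s ∪ t) * d' (s ∪ t)) := by
    calc ν s * d' s * (ν t * d' t) = (ν s * ν t) * (d' s * d' t) := by ring
      _ ≤ (ν (s ∩ t) * ν (s ∪ t)) * (d' (s ∩ t) * d' (s ∪ t)) :=
          mul_le_mul (hν s hs t ht) (hd'd' s t) (mul_nonneg (hd'0 s) (hd'0 t)) (mul_nonneg (hν0 _) (hν0 _))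
      _ = ν (s ∩ t) * d' (s ∩ t) * (ν (s ∪ t) * d' (s ∪ t)) := by ring
  have hlaw0 : 0 ≤ ν (s ∩ t) * d' (s ∩ t) * (ν (s ∪ t) * d' (s ∪ t)) :=
    mul_nonneg (mul_nonneg (hν0 _) (hd'0 _)) (mul_nonneg (hν0 _) (hd'0 _))
  rw [mg_x_inter j x hx, mg_x_inter j' y hy, mg_x_union j x hx, mg_x_union j' y hy]
  rcases mg_marker_cases j x hx s with hxs | hxs <;> rcases mg_marker_cases j x hx t with hxt | hxt <;>
    rcases mg_marker_cases j' y hy s with hys | hys <;> rcases mg_marker_cases j' y hy t with hyt | hyt <;>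
    simp only [hxs, hxt, hys, hyt] <;> ring_nf <;> nlinarith [hlaw, hlaw0]

end MGateFacts

section IMFacts

variable {V : Type*} [DecidableEq V] {R : Type*} [Field R] [LinearOrder R] [IsStrictOrderedRing R]
variable (U ent ent' : Finset V) (m j j' : V) (ν c d : Finset V → R)
variable (hν0 : ∀ W, 0 ≤ ν W) (hν : ∀ s ⊆ U, ∀ t ⊆ U, ν s * ν t ≤ ν (s ∩ t) * ν (s ∪ t))
  (hc0 : ∀ W, 0 ≤ c W) (hd0 : ∀ W, 0 ≤ d W) (hdc : ∀ W, d W ≤ c W)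
  (hcd : ∀ s t, c s * d t ≤ c (s ∩ t) * d (s ∪ t))
  (hratio : ∀ s t, s ⊆ t → d s * c t ≤ c s * d t)
  (x y : Finset V → R) (hx : ∀ W, x W = if j ∈ W then 1 else 0) (hy : ∀ W, y W = if j' ∈ W then 1 else 0)

include hν0 hν hc0 hd0 hdc hcd hratio hx hy in
/-- **The killed `x`-marked clusters against the sure-entered `y`-marked `x`-unmarked ones** (`IM_x`, weighted
form): the meet is an `ent`-free `x`-unmarked cluster of the piecewise killed law, the join carries both markers. -/
theorem mg_fact_IM :
    (∑ W ∈ U.powerset.filter (fun W => (¬ ∃ r ∈ ent, r ∈ W) ∧ ∃ r ∈ ent', r ∈ W), ν W * (c W - d W) * x W)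
      * (∑ W ∈ U.powerset.filter (fun W => ∃ r ∈ ent, r ∈ W), ν W * d W * (y W * (1 - x W))) ≤
    (∑ W ∈ U.powerset.filter (fun W => ¬ ∃ r ∈ ent, r ∈ W), ν W * (if ∃ r ∈ ent', r ∈ W then c W - d W else c W) * (1 - x W))
      * (∑ W ∈ U.powerset.filter (fun W => ∃ r ∈ ent, r ∈ W), ν W * d W * (x W * y W)) := by
  have hx0 := mg_x0 j x hx; have hy0 := mg_x0 j' y hy; have hx1 := mg_x1 j x hx; have hy1 := mg_x1 j' y hy
  have hpw0 : ∀ W, 0 ≤ (if ∃ r ∈ ent', r ∈ W then c W - d W else c W) := fun W => by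
    split_ifs <;> linarith [hdc W, hc0 W]
  have hcd0 : ∀ W, 0 ≤ c W - d W := fun W => by linarith [hdc W]
  refine ad_sets_dec U (fun W => ν W * (c W - d W) * x W) (fun W => ν W * d W * (y W * (1 - x W)))
    (fun W => ν W * (if ∃ r ∈ ent', r ∈ W then c W - d W else c W) * (1 - x W)) (fun W => ν W * d W * (x W * y W))
    (fun W => mul_nonneg (mul_nonneg (hν0 W) (hcd0 W)) (hx0 W))
    (fun W => mul_nonneg (mul_nonneg (hν0 W) (hd0 W)) (mul_nonneg (hy0 W) (by linarith [hx1 W])))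
    (fun W => mul_nonneg (mul_nonneg (hν0 W) (hpw0 W)) (by linarith [hx1 W]))
    (fun W => mul_nonneg (mul_nonneg (hν0 W) (hd0 W)) (mul_nonneg (hx0 W) (hy0 W)))
    (fun W => (¬ ∃ r ∈ ent, r ∈ W) ∧ ∃ r ∈ ent', r ∈ W) (fun W => ∃ r ∈ ent, r ∈ W)
    (fun W => ¬ ∃ r ∈ ent, r ∈ W) (fun W => ∃ r ∈ ent, r ∈ W) ?_
  intro s hs t ht hA hB
  refine ⟨fun ⟨r, hr, hrW⟩ => hA.1 ⟨r, hr, (Finset.mem_inter.1 hrW).1⟩,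
    by obtain ⟨r, hr, hrW⟩ := hB; exact ⟨r, hr, Finset.mem_union.2 (Or.inr hrW)⟩, ?_⟩
  have hpiece := cg_piece_pw ent' c d hc0 hd0 hdc hcd hratio s t
  rw [if_pos hA.2] at hpiece
  have hlaw : ν s * (c s - d s) * (ν t * d t) ≤
      ν (s ∩ t) * (if ∃ r ∈ ent', r ∈ s ∩ t then c (s ∩ t) - d (s ∩ t) else c (s ∩ t)) * (ν (s ∪ t) * d (s ∪ t)) := by
    calc ν s * (c s - d s) * (ν t * d t) = (ν s * ν t) * ((c s - d s) * d t) := by ring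
      _ ≤ (ν (s ∩ t) * ν (s ∪ t)) * ((if ∃ r ∈ ent', r ∈ s ∩ t then c (s ∩ t) - d (s ∩ t) else c (s ∩ t)) * d (s ∪ t)) :=
          mul_le_mul (hν s hs t ht) hpiece (mul_nonneg (hcd0 s) (hd0 t)) (mul_nonneg (hν0 _) (hν0 _))
      _ = ν (s ∩ t) * (if ∃ r ∈ ent', r ∈ s ∩ t then c (s ∩ t) - d (s ∩ t) else c (s ∩ t)) * (ν (s ∪ t) * d (s ∪ t)) := by ring
  have hlaw0 : 0 ≤ ν (s ∩ t) * (if ∃ r ∈ ent', r ∈ s ∩ t then c (s ∩ t) - d (s ∩ t) else c (s ∩ t)) * (ν (s ∪ t) * d (s ∪ t)) :=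
    mul_nonneg (mul_nonneg (hν0 _) (hpw0 _)) (mul_nonneg (hν0 _) (hd0 _))
  rw [mg_x_inter j x hx, mg_x_union j x hx, mg_x_union j' y hy]
  rcases mg_marker_cases j x hx s with hxs | hxs <;> rcases mg_marker_cases j x hx t with hxt | hxt <;>
    rcases mg_marker_cases j' y hy s with hys | hys <;> rcases mg_marker_cases j' y hy t with hyt | hyt <;>
    simp only [hxs, hxt, hys, hyt] <;> ring_nf <;> nlinarith [hlaw, hlaw0]

end IMFacts

end Summit.Ventures.PercRepro2.Coin
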